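import Literature.NumberTheory.LFunctions.YoshidaWindowGramFrontDoor
import HarnessLib

/-!
# Kernel enclosures of Yoshida's matrix coefficients — VI: per-column weights and the arctan far diagonal (odd sector)

Source: H. Yoshida, Adv. Stud. Pure Math. **21** (1992) 281–325, §§6–7 [Yoshida1992HermitianForms].  The odd
sector of the format-C front door (`WeilFormatC.weilPositivityOn_of_formatC_data`, hypothesis `hwo`) allows column
weights `0 < w_l ≤ d̂⁻_atan(l)` with the arctan-weighted Hilbert penalty `(π/2 − arctan(√B/√(l+1)))/2`; a CONSTANT
weight (part V) is ≈ 6× too weak at the base rung (measured: the odd 24×24 Schur matrix at `B₃ = 4000` is PSD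
with per-column weights and not with the constant one).  This file adds the per-column machinery:

* `Encl.colSumWL` / `Encl.frontBoxW` / `Encl.checkFrontRowsAuxW` / `Encl.near_front_of_checkAuxW` — Schur rows
  with a dyadic weight LIST `w_t = ws_t·2^{−cd}`;
* `Encl.devOddA` (the verbatim arctan far diagonal), `Encl.devOddABox` with `MI.arctan` at a certified rational
  `r/q ≤ √(B/(l+1))` (`Encl.checkSqrtLower`), `Encl.devOddABox_lo_le`;
* `Encl.checkWeightsOdd` ⇒ `Encl.weights_of_checkOdd` — the front door's `hwo` for the weight list;
* `Encl.odd_front_nearW` — the odd `hS` enclosure in the front door's exact shape with `wo l = ws_{l−B}·2^{−cd}`.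
Everything is proved; no named facts.
-/

open Real Complex Finset Matrix
open scoped BigOperators

namespace Literature.NumberTheory.LFunctions.Yoshida1992

open Literature.Analysis.SpecialFunctions Literature.Analysis.ValidatedNumerics.NumericsMP
open Literature.Analysis.ValidatedNumerics
open scoped ArithmeticFunction.vonMangoldt

namespace Encl

variable {S : ℕ} {a : ℝ} {prm : Params} {ks : List PrimeLen} {C : Consts} {tab ctab : List IdxRec}

/-! ## Schur rows with a weight list -/

/-- `Σ_{t<k} cols[t][i]·cols[t][j]·2^{cd}/ws_t`. [cite: Moore1966, Ch. 3 (interval arithmetic: inclusion property)] -/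
def colSumWL (S : ℕ) (cols : List (List MI)) (cd : ℕ) (ws : List ℕ) (i j : ℕ) : ℕ → MI
  | 0 => MI.ofInt S 0
  | t + 1 => (colSumWL S cols cd ws i j t).add
      (((((cols.getD t []).getD i default).mul S ((cols.getD t []).getD j default)).mulInt (2 ^ cd)).divNat (ws.getD t 0))

/-- The weight function of a dyadic weight list: `w(B + t) = ws_t·2^{−cd}`. [cite: Moore1966, Ch. 3 (interval arithmetic: inclusion property)] -/
noncomputable def woF (ws : List ℕ) (cd B : ℕ) : ℕ → ℝ := fun l ↦ ((ws.getD (l - B) 0 : ℕ) : ℝ) * (1 / 2 ^ cd)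

/-- [cite: Moore1966, Ch. 3 (interval arithmetic: inclusion property)] -/
theorem mem_colSumWL (hS : 0 < S) {M : ℕ → ℕ → ℝ} {B K cd : ℕ} {ws : List ℕ} (hws : ∀ t < K, 0 < ws.getD t 0)
    {cols : List (List MI)} (hcols : ColsValid S M B K cols) {i j : ℕ} (hi : i < B) (hj : j < B) :
    ∀ k ≤ K, MI.mem S (∑ t ∈ Finset.range k, M i (B + t) * M j (B + t) / woF ws cd B (B + t)) (colSumWL S cols cd ws i j k)
  | 0, _ => by simpa [colSumWL] using MI.mem_ofInt S 0
  | k + 1, hk => by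
      rw [Finset.sum_range_succ, colSumWL]
      have hk' : k < K := hk
      have h := MI.mem_divNat (MI.mem_mulInt (MI.mem_mul hS (hcols k hk' i hi) (hcols k hk' j hj)) (2 ^ cd)) (hws k hk')
      refine MI.mem_add (mem_colSumWL hS hws hcols hi hj k (by omega)) (mem_of_eq h ?_)
      have hw : (0 : ℝ) < ws.getD k 0 := by exact_mod_cast hws k hk'
      simp only [woF, Nat.add_sub_cancel_left]
      push_cast
      field_simp

/-- The Schur entry box with a weight list. [cite: Yoshida1992HermitianForms, §7 pp. 305–312] -/
def frontBoxW (odd : Bool) (S : ℕ) (C : Consts) (tab : List IdxRec) (cols : List (List MI)) (cd : ℕ) (ws : List ℕ)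
    (K : ℕ) (U2 : ℕ → ℕ → MI) (i j : ℕ) : MI :=
  (sectorBoxSym odd S C tab i j).sub ((colSumWL S cols cd ws i j K).add (U2 i j))

/-- Row-band check of the Schur matrix with a weight list (includes the positivity of the weights).
[cite: Moore1966, Ch. 3 (interval arithmetic: inclusion property)] -/
def checkFrontRowsAuxW (S c : ℕ) (ρS : ℤ) (C : Consts) (tab : List IdxRec) (odd : Bool) (B : ℕ)
    (cols : List (List MI)) (cd : ℕ) (ws : List ℕ) (K : ℕ) (U2 : ℕ → ℕ → MI) (DS : List (List ℤ)) (i0 k : ℕ) : Bool :=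
  (List.range K).all (fun t ↦ decide (0 < ws.getD t 0)) &&
    (List.range k).all fun di ↦ (List.range B).all fun j ↦
      enclCheck S c ρS (PsdDyadic.getMZ DS (i0 + di) j) (frontBoxW odd S C tab cols cd ws K U2 (i0 + di) j)

/-- The real Schur entry with a weight list. [cite: Yoshida1992HermitianForms, §7 pp. 305–312] -/
noncomputable def frontEntryW (M : ℕ → ℕ → ℝ) (B K cd : ℕ) (ws : List ℕ) (U₂ : ℕ → ℕ → ℝ) (i j : ℕ) : ℝ :=
  M i j - (∑ t ∈ Finset.range K, M i (B + t) * M j (B + t) / woF ws cd B (B + t)) - U₂ i j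

/-- **Soundness of `checkFrontRowsAuxW`.** [cite: Yoshida1992HermitianForms, §7 pp. 305–312] -/
theorem near_front_of_checkAuxW (hS : 0 < S) (ha0 : 0 < a) (hks : PrimeData a ks) (hC : ConstsValid S a ks C)
    {B : ℕ} (hT : TabValid S a ks (B + 1) tab) {odd : Bool} {K c cd : ℕ} {ws : List ℕ} {ρS : ℤ}
    {cols : List (List MI)} (hcols : ColsValid S (sectorKernel odd (gramCoeff a)) B K cols) {U2 : ℕ → ℕ → MI}
    {U₂ : ℕ → ℕ → ℝ} (hU2 : ∀ i < B, ∀ j < B, MI.mem S (U₂ i j) (U2 i j)) {DS : List (List ℤ)} {i0 k : ℕ}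
    (h : checkFrontRowsAuxW S c ρS C tab odd B cols cd ws K U2 DS i0 k = true)
    {i j : ℕ} (hi : i0 ≤ i) (hik : i < i0 + k) (hiB : i < B) (hj : j < B) :
    |frontEntryW (sectorKernel odd (gramCoeff a)) B K cd ws U₂ i j - (PsdDyadic.getMZ DS i j : ℝ) * (1 / 2 ^ c)|
      ≤ (ρS : ℝ) * (1 / 2 ^ c) := by
  simp only [checkFrontRowsAuxW, Bool.and_eq_true, List.all_eq_true, List.mem_range, decide_eq_true_eq] at h
  obtain ⟨hws, hrows⟩ := h
  have h2 := hrows (i - i0) (by omega) j hj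
  rw [show i0 + (i - i0) = i by omega] at h2
  refine abs_sub_le_of_enclCheck hS h2 ?_
  unfold frontEntryW frontBoxW
  have hM := mem_sectorBoxSym hS ha0 hks hC hT odd (i := i) (j := j) (by omega) (by omega)
  have hU1 := mem_colSumWL hS (cd := cd) hws hcols hiB hj K le_rfl
  exact mem_of_eq (MI.mem_sub hM (MI.mem_add hU1 (hU2 i hiB j hj))) (by ring)

/-! ## The arctan far diagonal of the odd sector and per-column weights -/

/-- The ODD far diagonal `d̂⁻_atan(l)` of the front door (verbatim RHS of `hwo`). [cite: Yoshida1992HermitianForms, §7 pp. 305–312] -/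
noncomputable def devOddA (a : ℝ) (Bo l : ℕ) : ℝ :=
  (reDigammaQuarter (freq a ((l : ℤ) + 1)) - Real.log π) / 2 - 1 / (8 * ((l : ℝ) + 1))
    - a * (1 + weilArchDensity (2 * a)) / (π ^ 2 * ((l : ℝ) + 1) ^ 2)
    - (π / 2 - Real.arctan (Real.sqrt Bo / Real.sqrt ((l : ℝ) + 1))) / 2
    - a * (1 + weilArchDensity (2 * a)) / π ^ 2 * Real.sqrt (8 / Bo)
    - (∑ k ∈ weilPrimeIndex a, (Λ k : ℝ) / Real.sqrt k * (2 * Real.cos (π / (⌊2 * a / Real.log k⌋₊ + 2)))) / 2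
    - (Real.exp (a / 2) - Real.exp (-(a / 2))) ^ 2 * a / (π ^ 2 * Bo)

/-- A rational square-root MINORANT: `(r/q)² ≤ num/den`. [cite: Moore1966, Ch. 3 (interval arithmetic: inclusion property)] -/
def checkSqrtLower (num den r q : ℕ) : Bool := decide (0 < q) && decide (0 < den) && decide (r ^ 2 * den ≤ num * q ^ 2)

/-- [cite: Moore1966, Ch. 3 (interval arithmetic: inclusion property)] -/
theorem le_sqrt_of_check {num den r q : ℕ} (h : checkSqrtLower num den r q = true) :
    (r : ℝ) / q ≤ Real.sqrt ((num : ℝ) / den) := by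
  simp only [checkSqrtLower, Bool.and_eq_true, decide_eq_true_eq] at h
  obtain ⟨⟨hq, hden⟩, hle⟩ := h
  have hq' : (0 : ℝ) < q := by exact_mod_cast hq
  have hden' : (0 : ℝ) < den := by exact_mod_cast hden
  have hle' : (r : ℝ) ^ 2 * den ≤ (num : ℝ) * (q : ℝ) ^ 2 := by exact_mod_cast hle
  refine Real.le_sqrt_of_sq_le ?_
  rw [div_pow, div_le_div_iff₀ (by positivity) hden']
  linarith

/-- Box of a minorant of `d̂⁻_atan(l)`: arctan at the rational `r/q ≤ √(Bo/(l+1))`, `√(8/Bo) ≤ p/q'`.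
[cite: Yoshida1992HermitianForms, §7 pp. 305–312] -/
def devOddABox (S Kser : ℕ) (C : Consts) (F : FDConsts) (R : IdxRec) (l Bo r q p q' : ℕ) : Option MI :=
  match MI.arctan S Kser C.P (MI.ofFrac S r q) with
  | some At =>
    some ((((((((R.reP.sub C.logPi).divNat 2).sub (MI.ofFrac S 1 (8 * (l + 1)))).sub
      ((F.Ca.mul S F.invPi2).divNat ((l + 1) * (l + 1)))).sub (((C.P.divNat 2).sub At).divNat 2)).sub
        ((F.Ca.mul S F.invPi2).mul S (MI.ofFrac S p q'))).sub (F.Aop.divNat 2)).sub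
          (((F.s2.mul S C.A).mul S F.invPi2).divNat Bo))
  | none => none

/-- **Lower bound of the arctan far diagonal**: `box.lo ≤ d̂⁻_atan(l)·S`. [cite: Yoshida1992HermitianForms, §7 pp. 305–312] -/
theorem devOddABox_lo_le (hS : 0 < S) (ha0 : 0 < a) (hC : ConstsValid S a ks C) {F : FDConsts} (hF : FDValid S a F)
    {R : IdxRec} {l : ℕ} (hR : MI.mem S (reDigammaQuarter (freq a ((l : ℤ) + 1))) R.reP) {Bo r q p q' Kser : ℕ}
    (hBo : 0 < Bo) (hr : checkSqrtLower Bo (l + 1) r q = true) (hp : checkSqrtUpper 8 Bo p q' = true) {Y : MI}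
    (h : devOddABox S Kser C F R l Bo r q p q' = some Y) : (Y.lo : ℝ) ≤ devOddA a Bo l * S := by
  have hq : 0 < q := by simp only [checkSqrtLower, Bool.and_eq_true, decide_eq_true_eq] at hr; exact hr.1.1
  have hq' : 0 < q' := by simp only [checkSqrtUpper, Bool.and_eq_true, decide_eq_true_eq] at hp; exact hp.1.1
  unfold devOddABox at h
  split at h
  · rename_i At hAt
    simp only [Option.some.injEq] at h
    subst h
    set Ca := a * (1 + weilArchDensity (2 * a)) with hCa
    have hCa0 : 0 ≤ Ca := by
      have := weilArchDensity_pos (show 0 < 2 * a by positivity); rw [hCa]; positivity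
    set s2 := (Real.exp (a / 2) - Real.exp (-(a / 2))) ^ 2 with hs2
    have hat := MI.mem_arctan hS hC.pi hAt (MI.mem_ofFrac S (r : ℤ) hq)
    have hY : MI.mem S ((reDigammaQuarter (freq a ((l : ℤ) + 1)) - Real.log π) / 2 - 1 / (8 * (l + 1) : ℕ)
        - Ca * (1 / π ^ 2) / ((l + 1) * (l + 1) : ℕ) - (π / 2 - Real.arctan (((r : ℤ) : ℝ) / q)) / 2
        - Ca * (1 / π ^ 2) * ((p : ℝ) / q') - primeOp a / 2 - s2 * a * (1 / π ^ 2) / Bo)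
        ((((((((R.reP.sub C.logPi).divNat 2).sub (MI.ofFrac S 1 (8 * (l + 1)))).sub
          ((F.Ca.mul S F.invPi2).divNat ((l + 1) * (l + 1)))).sub (((C.P.divNat 2).sub At).divNat 2)).sub
            ((F.Ca.mul S F.invPi2).mul S (MI.ofFrac S p q'))).sub (F.Aop.divNat 2)).sub
              (((F.s2.mul S C.A).mul S F.invPi2).divNat Bo)) := by
      refine MI.mem_sub (MI.mem_sub (MI.mem_sub (MI.mem_sub (MI.mem_sub (MI.mem_sub ?_ ?_) ?_) ?_) ?_) ?_) ?_
      · exact mem_of_eq (MI.mem_divNat (MI.mem_sub hR hC.logPi) (n := 2) (by norm_num)) (by norm_num)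
      · exact mem_of_eq (MI.mem_ofFrac S 1 (q := 8 * (l + 1)) (by omega)) (by push_cast; ring)
      · exact MI.mem_divNat (MI.mem_mul hS hF.Ca hF.invPi2) (by positivity)
      · have hp2 : MI.mem S (π / 2) (C.P.divNat 2) := mem_of_eq (MI.mem_divNat hC.pi (n := 2) (by norm_num)) (by norm_num)
        exact mem_of_eq (MI.mem_divNat (MI.mem_sub hp2 hat) (n := 2) (by norm_num)) (by norm_num)
      · exact mem_of_eq (MI.mem_mul hS (MI.mem_mul hS hF.Ca hF.invPi2) (MI.mem_ofFrac S p hq')) (by push_cast; ring)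
      · exact mem_of_eq (MI.mem_divNat hF.Aop (n := 2) (by norm_num)) (by norm_num)
      · exact mem_of_eq (MI.mem_divNat (MI.mem_mul hS (MI.mem_mul hS hF.s2 hC.ha) hF.invPi2) hBo) (by ring)
    have hle : (reDigammaQuarter (freq a ((l : ℤ) + 1)) - Real.log π) / 2 - 1 / (8 * (l + 1) : ℕ)
        - Ca * (1 / π ^ 2) / ((l + 1) * (l + 1) : ℕ) - (π / 2 - Real.arctan (((r : ℤ) : ℝ) / q)) / 2
        - Ca * (1 / π ^ 2) * ((p : ℝ) / q') - primeOp a / 2 - s2 * a * (1 / π ^ 2) / Bo ≤ devOddA a Bo l := by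
      unfold devOddA primeOp
      have hsu := sqrt_le_of_check hp
      have hsl := le_sqrt_of_check hr
      have h1 : Ca * (1 / π ^ 2) * Real.sqrt (8 / (Bo : ℝ)) ≤ Ca * (1 / π ^ 2) * ((p : ℝ) / q') :=
        mul_le_mul_of_nonneg_left (by exact_mod_cast hsu) (by positivity)
      have h2 : Real.arctan (((r : ℤ) : ℝ) / q) ≤ Real.arctan (Real.sqrt Bo / Real.sqrt ((l : ℝ) + 1)) := by
        refine Real.arctan_strictMono.monotone ?_
        rw [← Real.sqrt_div (Nat.cast_nonneg Bo)]
        have : ((r : ℤ) : ℝ) / q = (r : ℝ) / q := by push_cast; ring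
        rw [this]
        have e : Real.sqrt ((Bo : ℝ) / ((l + 1 : ℕ) : ℝ)) = Real.sqrt ((Bo : ℝ) / ((l : ℝ) + 1)) := by push_cast; ring_nf
        exact hsl.trans (le_of_eq e)
      have hl0 : (0 : ℝ) < (l : ℝ) + 1 := by positivity
      have e1 : Ca * (1 / π ^ 2) / (((l + 1) * (l + 1) : ℕ) : ℝ) = a * (1 + weilArchDensity (2 * a)) / (π ^ 2 * ((l : ℝ) + 1) ^ 2) := by
        rw [hCa]; push_cast; field_simp
      have e2 : (1 : ℝ) / ((8 * (l + 1) : ℕ) : ℝ) = 1 / (8 * ((l : ℝ) + 1)) := by push_cast; ring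
      have e3 : Ca * (1 / π ^ 2) * Real.sqrt (8 / (Bo : ℝ)) = a * (1 + weilArchDensity (2 * a)) / π ^ 2 * Real.sqrt (8 / Bo) := by
        rw [hCa]; ring
      have e4 : s2 * a * (1 / π ^ 2) / Bo = (Real.exp (a / 2) - Real.exp (-(a / 2))) ^ 2 * a / (π ^ 2 * Bo) := by
        rw [hs2]; field_simp
      rw [e1, e2, e4]; linarith [h1, h2, e3]
    have hSr : (0 : ℝ) < S := by exact_mod_cast hS
    exact hY.1.trans (by nlinarith)
  · simp at h

/-- **Per-column weight certificate (odd)**: for every `t < K`, with `l = Bo + t` and the light record at mode `l + 1`,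
the weight `ws_t·2^{−cd}` is positive and at most the certified minorant of `d̂⁻_atan(l)` (arctan at `rs_t/q`).
[cite: Moore1966, Ch. 3 (interval arithmetic: inclusion property)] -/
def checkWeightsOdd (S Kser : ℕ) (C : Consts) (F : FDConsts) (ctab : List IdxRec) (Bo K cd : ℕ) (ws rs : List ℕ)
    (q p q' : ℕ) : Bool :=
  (List.range K).all fun t ↦
    decide (0 < ws.getD t 0) && checkSqrtLower Bo (Bo + t + 1) (rs.getD t 0) q &&
    match devOddABox S Kser C F (tget ctab (Bo + t + 1)) (Bo + t) Bo (rs.getD t 0) q p q' with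
    | some Y => decide (((ws.getD t 0 : ℕ) : ℤ) * (S : ℤ) ≤ Y.lo * 2 ^ cd)
    | none => false

/-- **Soundness of `checkWeightsOdd`** = the front door's `hwo` for the weight function `woF ws cd Bo`.
[cite: Yoshida1992HermitianForms, §7 pp. 305–312] -/
theorem weights_of_checkOdd (hS : 0 < S) (ha0 : 0 < a) (hC : ConstsValid S a ks C) {F : FDConsts} (hF : FDValid S a F)
    {Bo K cd Kser q p q' : ℕ} (hBo : 0 < Bo) (hp : checkSqrtUpper 8 Bo p q' = true) {ws rs : List ℕ}
    {N : ℕ} (hCT : TabColValid S a ks Bo N ctab) (hKN : Bo + K + 1 ≤ N)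
    (h : checkWeightsOdd S Kser C F ctab Bo K cd ws rs q p q' = true) (l : ℕ) (hl : Bo ≤ l) (hlK : l < Bo + K) :
    0 < woF ws cd Bo l ∧ woF ws cd Bo l ≤ devOddA a Bo l := by
  simp only [checkWeightsOdd, List.all_eq_true, List.mem_range, Bool.and_eq_true, decide_eq_true_eq] at h
  obtain ⟨⟨hpos, hsq⟩, hbox⟩ := h (l - Bo) (by omega)
  have el : Bo + (l - Bo) = l := by omega
  rw [el] at hsq hbox
  split at hbox
  · rename_i Y hY
    simp only [decide_eq_true_eq] at hbox
    have hre : MI.mem S (reDigammaQuarter (freq a ((l : ℤ) + 1))) (tget ctab (l + 1)).reP := by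
      have h := (hCT (l + 1) (by omega) (by omega)).2
      push_cast at h; exact h
    have hlo := devOddABox_lo_le hS ha0 hC hF hre hBo hsq hp hY
    refine ⟨?_, ?_⟩
    · simp only [woF]; have : (0 : ℝ) < ws.getD (l - Bo) 0 := by exact_mod_cast hpos
      positivity
    · simp only [woF]
      have := dyadic_le_of_lo' hS hbox hlo
      exact_mod_cast this
  · simp at hbox
where
  /-- `z·S ≤ lo·2^cd`, `lo ≤ v·S` ⟹ `z·2^{−cd} ≤ v`. -/
  dyadic_le_of_lo' {z lo : ℤ} {cd' : ℕ} {v : ℝ} (hS' : 0 < S) (hz : z * (S : ℤ) ≤ lo * 2 ^ cd')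
      (hlo : (lo : ℝ) ≤ v * S) : (z : ℝ) * (1 / 2 ^ cd') ≤ v := by
    have hSr : (0 : ℝ) < S := by exact_mod_cast hS'
    have h2 : (0 : ℝ) < 2 ^ cd' := by positivity
    have hz' : (z : ℝ) * S ≤ lo * 2 ^ cd' := by exact_mod_cast hz
    rw [mul_one_div, div_le_iff₀ h2]
    nlinarith

/-! ## The odd `hS` with per-column weights, verbatim -/

/-- The odd front-door entry with the weight function `woF` equals `frontEntryW`. [cite: Yoshida1992HermitianForms, §7 pp. 305–312] -/
theorem odd_entry_eq_frontEntryW (a : ℝ) (Bo B3o : ℕ) (cd d0z : ℕ) (ws : List ℕ) (k k' : Fin Bo) :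
    ((((gramCoeff a (((k : ℕ) : ℤ) + 1) (((k' : ℕ) : ℤ) + 1) - gramCoeff a (((k : ℕ) : ℤ) + 1) (-(((k' : ℕ) : ℤ) + 1))) / 2)
      - (∑ l ∈ Finset.Ico Bo B3o, ((gramCoeff a (((k : ℕ) : ℤ) + 1) ((l : ℤ) + 1) - gramCoeff a (((k : ℕ) : ℤ) + 1) (-((l : ℤ) + 1))) / 2) *
          ((gramCoeff a (((k' : ℕ) : ℤ) + 1) ((l : ℤ) + 1) - gramCoeff a (((k' : ℕ) : ℤ) + 1) (-((l : ℤ) + 1))) / 2) /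
            (woF ws cd Bo l))
      - U2Odd a 1 ((d0z : ℝ) * (1 / 2 ^ cd)) Bo B3o k k'))
    = frontEntryW (sectorKernel true (gramCoeff a)) Bo (B3o - Bo) cd ws
        (fun k k' ↦ U2Odd a 1 ((d0z : ℝ) * (1 / 2 ^ cd)) Bo B3o k k') k k' := by
  unfold frontEntryW
  simp only [sectorKernel, oddKernel, if_true]
  congr 1
  congr 1
  rw [Finset.sum_Ico_eq_sum_range]

/-- **ODD `hS` of the front door with per-column weights.** [cite: Yoshida1992HermitianForms, §7 pp. 305–312] -/
theorem odd_front_nearW (hS : 0 < S) (ha0 : 0 < a) (hks : PrimeData a ks) (hC : ConstsValid S a ks C)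
    {F : FDConsts} (hF : FDValid S a F) {Bo B3o : ℕ} (hBo : 1 ≤ Bo) (hBB : Bo ≤ B3o)
    (hT : TabValid S a ks (Bo + 1) tab) (hCT : TabColValid S a ks Bo (B3o + 1) ctab)
    {c cd d0z : ℕ} {ws : List ℕ} (hd0 : 0 < d0z) {ρS : ℤ} {DS : List (List ℤ)} {i0 k : ℕ}
    (h : checkFrontRowsAuxW S c ρS C tab true Bo (colList true S C tab ctab Bo (B3o - Bo)) cd ws (B3o - Bo)
      (u2OddBox S C F tab cd d0z Bo B3o) DS i0 k = true)
    (kk kk' : Fin Bo) (hi : i0 ≤ kk) (hik : (kk : ℕ) < i0 + k) :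
    |(((gramCoeff a (((kk : ℕ) : ℤ) + 1) (((kk' : ℕ) : ℤ) + 1) - gramCoeff a (((kk : ℕ) : ℤ) + 1) (-(((kk' : ℕ) : ℤ) + 1))) / 2)
      - (∑ l ∈ Finset.Ico Bo B3o, ((gramCoeff a (((kk : ℕ) : ℤ) + 1) ((l : ℤ) + 1) - gramCoeff a (((kk : ℕ) : ℤ) + 1) (-((l : ℤ) + 1))) / 2) *
          ((gramCoeff a (((kk' : ℕ) : ℤ) + 1) ((l : ℤ) + 1) - gramCoeff a (((kk' : ℕ) : ℤ) + 1) (-((l : ℤ) + 1))) / 2) /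
            (woF ws cd Bo l))
      - U2Odd a 1 ((d0z : ℝ) * (1 / 2 ^ cd)) Bo B3o kk kk')
      - (PsdDyadic.getMZ DS kk kk' : ℝ) * (1 / 2 ^ c)| ≤ (ρS : ℝ) * (1 / 2 ^ c) := by
  rw [odd_entry_eq_frontEntryW a Bo B3o cd d0z ws kk kk']
  have hcols := colsValid_colList hS ha0 hks hC hBo hT (K := B3o - Bo)
    (by rw [Nat.add_sub_cancel' hBB]; exact hCT) true
  exact near_front_of_checkAuxW hS ha0 hks hC hT hcols
    (fun i hi j hj ↦ mem_u2OddBox hS hks hC hF hT hd0 (by omega) (by omega) (by omega)) h hi hik kk.isLt kk'.isLt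

end Encl

end Literature.NumberTheory.LFunctions.Yoshida1992
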